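/-
Copyright (c) 2026 the pub-hodgecm-mathlib formalisation cell (harness21).  Prover seat hodgecm-mathlib-K2E4-p09 (g3), Track B «K2-LIT» ∕ h413, road (d-w) of ‹J3› v2, letter (C-ratio),
brick (C1-I) «IWAHORI LEVEL COUNT», FILE 3a: the three abelian counts at a WILD ramified CM place — skew balls against `|4|`, and the unit level `1 + 4𝒪_w`.  2026-09-04.
-/
import Literature.NumberTheory.Weil1982.UnitaryFinTopFormLieGramWildKit                -- ★ (L) KIT (this seat): `relIndex_skewBall_eq_pow_of_antifixed`, `valued_le_of_skew_of_le_exp_even_of_antifixed`, `exists_toPlace_mul_eq_of_skew`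
import Literature.NumberTheory.LocalFields.RamifiedQuadraticResidueCountsUnits         -- ★ (C3) `WildQuadraticDatum.relIndex_unitLevel_eq` (`[𝒪^× : 1 + 𝔭ⁿ] = (q−1)q^{n−1}`)
import Literature.NumberTheory.Automorphic.UnitaryGroupIntegralPointsReductionRamified -- ★ `natCard_residueField_eq_of_ramified` (`#𝓀[L_w] = q_v` at a ramified place)
import Literature.NumberTheory.Automorphic.ValuedFieldValuativeRelBridge              -- ★ `natCard_residueField_eq_of_compatible` (the `Valued` and `ValuativeRel` residue fields agree)
import HarnessLib

/-!
# The abelian counts of the wild Iwahori factorisation: `[𝒪_w⁻ : (4𝒪_w)⁻] = q^{2m}`, `[𝔪_w⁻ : (4𝒪_w)⁻] = q^{2m−1+s}`, `[𝒪_w^× : 1 + 4𝒪_w] = (q−1)·q^{4m−1}`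
# at a ramified CM place with `|2|_v = exp(−m)`, `m ≥ 1`, and an anti-fixed generator of valuation `exp(−s)`
# (Serre, *Local Fields* II §3 Prop. 5, IV §1–2 Prop. 6; Jacobowitz 1962 §§9–11)

Topic `NumberTheory/Weil1982`; namespace `Literature.NumberTheory.Weil1982.UnitaryFinTopForm` (continues ★ (L) KIT `UnitaryFinTopFormLieGramWildKit`).  THEOREMS ONLY (no definition, no
instance, no notation, no axiom, no named fact, no `sorry`); kernel lane `--kind proof --supports stmt-HodgeConjecture-24833` (count-neutral).  Cell `pub/hodgecm-mathlib`, crux H413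
(`stmt-HodgeConjecture-24833`), Track B «K2-LIT», road J of ‹S›, letter ‹J3› v2 leaf (J3d-w) ⟸ (W3) ⟸ (C-ratio) ⟸ (C1)+(C2) (road owner K2E3-p03 (g3), `K2/K2E3-p03/g3/TARGETS-Cratio…md`),
brick **(C1-I) «IWAHORI LEVEL COUNT»** `[I : K⁰(4)] = (q−1)·q^{8m−2+s}`: ★ FILES 1–2 `UnitaryTwoAntidiagIwahoriCosets` ∕ `…LevelIndices` (this seat) reduce it, in the one-place model
`U(σ, antidiag(1,1)) ≤ GL₂(L_w)`, to `[𝔪⁻ : (4𝒪)⁻] · [𝒪^× : 1+4𝒪] · [𝒪⁻ : (4𝒪)⁻]`; THIS FILE evaluates the three factors at a ramified CM place `w ∣ v` with `|2|_v = exp(−m)`, `m ≥ 1`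
(a DYADIC place) and an anti-fixed generator `α` (`σ_w α = −α`, `|α|_w = exp(−s)`, `s ≤ 1`; `s = 1` √π, `s = 0` √u); FILE 3b (Summits-side) transports along `E₂` and multiplies.

THE MATHEMATICS (`q = #(𝓞_{L⁺}∕𝔭_v) = #𝓀_w`, `σ = σ_w`; membership letters as in ★ FILE 2).  `|4|_w = |2|_v⁴ = exp(−4m)` (★ `valued_two_eq_sq_of_ramified`, §0).  The skew line is `ι(L⁺_v)·α`
with valuations `≡ −s (mod 2)` (★ KIT), so `(4𝒪_w)⁻ = {skew, ≤ exp(−4m)} = {skew, ≤ exp(2·(−2m) − s)}`, `𝒪_w⁻ = {skew, ≤ exp(2·0 − s)}` and `𝔪_w⁻ = {skew, < 1} = {skew, ≤ exp(s − 2)}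
= {skew, ≤ exp(2(s − 1) − s)}` (§1 `valued_le_exp_sub_two_of_skew_of_lt_one`); ★ KIT `relIndex_skewBall_eq_pow_of_antifixed` then gives **`[𝒪⁻ : (4𝒪)⁻] = q^{2m}`** (§1
`relIndex_skewBall_four_one_eq_pow`, `k = 2m`) and **`[𝔪⁻ : (4𝒪)⁻] = q^{2m−1+s}`** (§1 `relIndex_skewBall_four_lt_one_eq_pow`, `k = (s − 1) + 2m`).  The unit level: ★ (C3)
`WildQuadraticDatum.relIndex_unitLevel_eq` at `n = 4m` over `K = L_w` and `#𝓀[L_w] = q` (★ `natCard_residueField_eq_of_ramified`, `f(w|v) = 1`) give **`[𝒪_w^× : 1 + 4𝒪_w] =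
(q − 1)·q^{4m−1}`** (§2 `relIndex_unitLevel_four_eq`).  Product: `q^{2m−1+s}·(q−1)q^{4m−1}·q^{2m} = (q−1)·q^{8m−2+s}` — `(q−1)q^{8m−1}` (√π) ∕ `(q−1)q^{8m−2}` (√u), the (C1-I) TARGETS.
HONEST LABEL: count-neutral local algebra toward (C1)∕(C-ratio); HC_CM is proved only modulo the 7 printed citations (2 remaining named inputs: hLiu418 = `stmt-HodgeConjecture-24832`,
h413 = `stmt-HodgeConjecture-24833`) until rung 0 closes; (C1)∕(C-ratio) are NOT proved here.

## References
* [Serre1979] J.-P. Serre, *Local Fields*, GTM 67 (1979), Ch. II §3 Prop. 5 (indices of `𝔭ⁿ`), Ch. IV §1–2, Prop. 6 (the unit filtration; `e = 2`).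
* [Jacobowitz1962] R. Jacobowitz, Hermitian forms over local fields, Amer. J. Math. 84 (1962), §§9–11 (ramified dyadic: the `F(√u)` ∕ `F(√π)` types).
* [Tits1979] J. Tits, *Reductive groups over local fields*, PSPM 33.1 (1979), §3.7 (Iwahori subgroups: the count these factors assemble).
-/

set_option autoImplicit false

noncomputable section

open NumberField IsDedekindDomain IsLocalRing Matrix
open Literature.NumberTheory.Automorphic Literature.NumberTheory.Automorphic.UnitaryGroup
open scoped MatrixGroups Matrix NNReal Valued WithZero

namespace Literature.NumberTheory.Weil1982.UnitaryFinTopForm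

variable (L : Type) [Field L] [NumberField L] [IsCMField L] (v : HeightOneSpectrum (𝓞 ↥(maximalRealSubfield L)))
  (w : PlacesOver L v) (hw : IsCMField.complexConj L • w.1 = w.1) (he : v.asIdeal.ramificationIdx' w.1.asIdeal ≠ 1)

/-! ## §0 `|4|_w = exp(−4m)` -/

include hw he in
/-- **`|4|_w = exp(−4m)`** at a ramified place with `|2|_v = exp(−m)` (`|2|_w = |2|_v²`, ★ `valued_two_eq_sq_of_ramified`). [cite: Serre1979, Ch. IV §1] -/
theorem valued_four_eq_of_ramified {m : ℕ} (hm : Valued.v (2 : v.adicCompletion ↥(maximalRealSubfield L)) = WithZero.exp (-(m : ℤ))) :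
    Valued.v (4 : w.1.adicCompletion L) = WithZero.exp (-(4 * (m : ℤ))) := by
  rw [show (4 : w.1.adicCompletion L) = 2 * 2 by norm_num, map_mul, valued_two_eq_sq_of_ramified L v w hw he, hm, ← pow_add, ← WithZero.exp_nsmul]
  congr 1; simp only [nsmul_eq_mul]; push_cast; ring

/-! ## §1 The skew balls against `|4|` -/

include hw he in
/-- **Skew valuations are `≡ −s (mod 2)`, sharp form at `1`**: if `σα = −α`, `|α| = exp(−s)` (`s ≤ 1`), `σx = −x` and `|x| < 1`, then `|x| ≤ exp(s − 2)` — `x = ι(c)·α` has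
`|x| = |c|_v²·exp(−s)` (★ KIT), and `2n − s < 0` forces `2n − s ≤ s − 2` for `s ∈ {0, 1}`. [cite: Serre1979, Ch. IV §2] [cite: Jacobowitz1962, §9] -/
theorem valued_le_exp_sub_two_of_skew_of_lt_one {α : w.1.adicCompletion L} (hσα : galAdicCompletionMap (L := L) (IsCMField.complexConj L) hw α = -α)
    {s : ℕ} (hs : s ≤ 1) (hα : Valued.v α = WithZero.exp (-(s : ℤ)))
    {x : w.1.adicCompletion L} (hx : galAdicCompletionMap (L := L) (IsCMField.complexConj L) hw x = -x) (hx1 : Valued.v x < 1) :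
    Valued.v x ≤ WithZero.exp ((s : ℤ) - 2) := by
  have hα0 : α ≠ 0 := fun h0 => by rw [h0, map_zero] at hα; exact WithZero.zero_ne_coe hα
  obtain ⟨c, rfl⟩ := exists_toPlace_mul_eq_of_skew L v w hw hσα hα0 hx
  rcases eq_or_ne c 0 with rfl | hc0
  · rw [map_zero, zero_mul, map_zero]; exact zero_le
  obtain ⟨n, hn⟩ : ∃ n : ℤ, Valued.v c = WithZero.exp n := ⟨_, (WithZero.exp_log ((Valuation.ne_zero_iff _).2 hc0)).symm⟩
  rw [map_mul, valued_toPlace_eq_sq_of_ramified L v w hw he, hα, hn, ← WithZero.exp_nsmul, ← WithZero.exp_add, WithZero.exp_le_exp]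
  rw [map_mul, valued_toPlace_eq_sq_of_ramified L v w hw he, hα, hn, ← WithZero.exp_nsmul, ← WithZero.exp_add, ← WithZero.exp_zero, WithZero.exp_lt_exp] at hx1
  simp only [nsmul_eq_mul, Nat.cast_ofNat] at hx1 ⊢
  omega

include hw he in
/-- **`[𝒪_w⁻ : (4𝒪_w)⁻] = q^{2m}`** at a ramified place with `|2|_v = exp(−m)` and an anti-fixed generator of valuation `exp(−s)` (`s ≤ 1`): both skew balls are `exp(2j − s)`-balls of the
skew line (`j = 0`, `j = −2m`, ★ KIT parity), so ★ KIT `relIndex_skewBall_eq_pow_of_antifixed` applies with `k = 2m`. [cite: Serre1979, Ch. II §3 Prop. 5] [cite: Jacobowitz1962, §9] -/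
theorem relIndex_skewBall_four_one_eq_pow {m s : ℕ} (hm : Valued.v (2 : v.adicCompletion ↥(maximalRealSubfield L)) = WithZero.exp (-(m : ℤ))) (hs : s ≤ 1)
    (hα : ∃ α : w.1.adicCompletion L, galAdicCompletionMap (L := L) (IsCMField.complexConj L) hw α = -α ∧ Valued.v α = WithZero.exp (-(s : ℤ)))
    {S0 S4 : AddSubgroup (w.1.adicCompletion L)}
    (hS0 : ∀ x, x ∈ S0 ↔ galAdicCompletionMap (L := L) (IsCMField.complexConj L) hw x = -x ∧ Valued.v x ≤ 1)
    (hS4 : ∀ x, x ∈ S4 ↔ galAdicCompletionMap (L := L) (IsCMField.complexConj L) hw x = -x ∧ Valued.v x ≤ Valued.v (4 : w.1.adicCompletion L)) :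
    S4.relIndex S0 = Nat.card (𝓞 ↥(maximalRealSubfield L) ⧸ v.asIdeal) ^ (2 * m) := by
  obtain ⟨α, hσα, hvα⟩ := hα
  have h4 := valued_four_eq_of_ramified L v w hw he hm
  obtain ⟨T, hT⟩ := exists_addSubgroup_skew_le L v w hw (WithZero.exp (2 * (-(2 * (m : ℤ))) - (s : ℤ)))
  obtain ⟨T', hT'⟩ := exists_addSubgroup_skew_le L v w hw (WithZero.exp (2 * (-(2 * (m : ℤ)) + ((2 * m : ℕ) : ℤ)) - (s : ℤ)))
  have hidx := relIndex_skewBall_eq_pow_of_antifixed L v w hw he hσα hvα (-(2 * (m : ℤ))) (2 * m) T T' hT hT'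
  have hs0 : WithZero.exp (-(s : ℤ)) ≤ 1 := by rw [← WithZero.exp_zero, WithZero.exp_le_exp]; omega
  have hS4T : S4 = T := by
    ext x
    rw [hS4, hT, h4]
    refine ⟨fun h => ⟨h.1, ?_⟩, fun h => ⟨h.1, h.2.trans (WithZero.exp_le_exp.2 (by omega))⟩⟩
    have h' := valued_le_of_skew_of_le_exp_even_of_antifixed L v w hw he hσα hs hvα h.1 (-(2 * (m : ℤ))) (by rw [show (2 * (-(2 * (m : ℤ)))) = -(4 * (m : ℤ)) by ring]; exact h.2)
    exact h'
  have hS0T' : S0 = T' := by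
    ext x
    rw [hS0, hT', show (2 * (-(2 * (m : ℤ)) + ((2 * m : ℕ) : ℤ)) - (s : ℤ)) = -(s : ℤ) by push_cast; ring]
    refine ⟨fun h => ⟨h.1, ?_⟩, fun h => ⟨h.1, h.2.trans hs0⟩⟩
    have h' := valued_le_of_skew_of_le_exp_even_of_antifixed L v w hw he hσα hs hvα h.1 0 (by rw [mul_zero, WithZero.exp_zero]; exact h.2)
    rwa [mul_zero, zero_sub] at h'
  rw [hS4T, hS0T', hidx]

include hw he in
/-- **`[𝔪_w⁻ : (4𝒪_w)⁻] = q^{2m−1+s}`** at a ramified place with `|2|_v = exp(−m)`, `m ≥ 1`, and an anti-fixed generator of valuation `exp(−s)` (`s ≤ 1`): `𝔪⁻ = {skew, ≤ exp(2(s−1) − s)}`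
(§1) and `(4𝒪)⁻ = {skew, ≤ exp(2·(−2m) − s)}`, so ★ KIT applies with `k = 2m − 1 + s` — `q^{2m}` at a √π place, `q^{2m−1}` at a √u place. [cite: Serre1979, Ch. II §3 Prop. 5]
[cite: Jacobowitz1962, §§9–11] -/
theorem relIndex_skewBall_four_lt_one_eq_pow {m s : ℕ} (hm : Valued.v (2 : v.adicCompletion ↥(maximalRealSubfield L)) = WithZero.exp (-(m : ℤ))) (hm1 : 1 ≤ m) (hs : s ≤ 1)
    (hα : ∃ α : w.1.adicCompletion L, galAdicCompletionMap (L := L) (IsCMField.complexConj L) hw α = -α ∧ Valued.v α = WithZero.exp (-(s : ℤ)))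
    {Sm S4 : AddSubgroup (w.1.adicCompletion L)}
    (hSm : ∀ x, x ∈ Sm ↔ galAdicCompletionMap (L := L) (IsCMField.complexConj L) hw x = -x ∧ Valued.v x < 1)
    (hS4 : ∀ x, x ∈ S4 ↔ galAdicCompletionMap (L := L) (IsCMField.complexConj L) hw x = -x ∧ Valued.v x ≤ Valued.v (4 : w.1.adicCompletion L)) :
    S4.relIndex Sm = Nat.card (𝓞 ↥(maximalRealSubfield L) ⧸ v.asIdeal) ^ (2 * m - 1 + s) := by
  obtain ⟨m', rfl⟩ : ∃ m', m = m' + 1 := ⟨m - 1, by omega⟩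
  obtain ⟨α, hσα, hvα⟩ := hα
  have h4 := valued_four_eq_of_ramified L v w hw he hm
  obtain ⟨T, hT⟩ := exists_addSubgroup_skew_le L v w hw (WithZero.exp (2 * (-(2 * ((m' + 1 : ℕ) : ℤ))) - (s : ℤ)))
  obtain ⟨T', hT'⟩ := exists_addSubgroup_skew_le L v w hw (WithZero.exp (2 * (-(2 * ((m' + 1 : ℕ) : ℤ)) + ((2 * m' + 1 + s : ℕ) : ℤ)) - (s : ℤ)))
  have hidx := relIndex_skewBall_eq_pow_of_antifixed L v w hw he hσα hvα (-(2 * ((m' + 1 : ℕ) : ℤ))) (2 * m' + 1 + s) T T' hT hT'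
  have hS4T : S4 = T := by
    ext x
    rw [hS4, hT, h4]
    refine ⟨fun h => ⟨h.1, ?_⟩, fun h => ⟨h.1, h.2.trans (WithZero.exp_le_exp.2 (by push_cast; omega))⟩⟩
    exact valued_le_of_skew_of_le_exp_even_of_antifixed L v w hw he hσα hs hvα h.1 (-(2 * ((m' + 1 : ℕ) : ℤ)))
      (by rw [show (2 * (-(2 * ((m' + 1 : ℕ) : ℤ)))) = -(4 * ((m' + 1 : ℕ) : ℤ)) by ring]; exact h.2)
  have hSmT' : Sm = T' := by
    ext x
    rw [hSm, hT', show (2 * (-(2 * ((m' + 1 : ℕ) : ℤ)) + ((2 * m' + 1 + s : ℕ) : ℤ)) - (s : ℤ)) = (s : ℤ) - 2 by push_cast; ring]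
    refine ⟨fun h => ⟨h.1, valued_le_exp_sub_two_of_skew_of_lt_one L v w hw he hσα hs hvα h.1 h.2⟩, fun h => ⟨h.1, lt_of_le_of_lt h.2 ?_⟩⟩
    rw [← WithZero.exp_zero, WithZero.exp_lt_exp]; omega
  rw [hS4T, hSmT', hidx, show 2 * (m' + 1) - 1 + s = 2 * m' + 1 + s by omega]

/-! ## §2 The unit level `[𝒪_w^× : 1 + 4𝒪_w] = (q−1)·q^{4m−1}` -/

include hw he in
/-- **`[𝒪_w^× : 1 + 4𝒪_w] = (q − 1)·q^{4m−1}`** at a ramified place with `|2|_v = exp(−m)`, `m ≥ 1`: ★ (C3) `WildQuadraticDatum.relIndex_unitLevel_eq` over `K = L_w` at `n = 4m` (`|4|_w = exp(−4m)`)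
and `#𝓀[L_w] = q` (★ `natCard_residueField_eq_of_ramified`). [cite: Serre1979, Ch. IV §2 Prop. 6] -/
theorem relIndex_unitLevel_four_eq {m : ℕ} (hm : Valued.v (2 : v.adicCompletion ↥(maximalRealSubfield L)) = WithZero.exp (-(m : ℤ))) (hm1 : 1 ≤ m)
    {U1 U4 : Subgroup (w.1.adicCompletion L)ˣ} (hU1 : ∀ u : (w.1.adicCompletion L)ˣ, u ∈ U1 ↔ Valued.v (u : w.1.adicCompletion L) = 1)
    (hU4 : ∀ u : (w.1.adicCompletion L)ˣ, u ∈ U4 ↔ Valued.v (u : w.1.adicCompletion L) = 1 ∧ Valued.v ((u : w.1.adicCompletion L) - 1) ≤ Valued.v (4 : w.1.adicCompletion L)) :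
    U4.relIndex U1 = (Nat.card (𝓞 ↥(maximalRealSubfield L) ⧸ v.asIdeal) - 1) * Nat.card (𝓞 ↥(maximalRealSubfield L) ⧸ v.asIdeal) ^ (4 * m - 1) := by
  have hc1 : IsCMField.complexConj L ≠ 1 := IsCMField.complexConj_ne_one L
  have h4 := valued_four_eq_of_ramified L v w hw he hm
  obtain ⟨π, hπ⟩ := w.1.valuation_exists_uniformizer L
  have hτ : Valued.v (π : w.1.adicCompletion L) = WithZero.exp (-1 : ℤ) := by rw [HeightOneSpectrum.valuedAdicCompletion_eq_valuation', hπ]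
  have h := Literature.NumberTheory.LocalFields.WildQuadraticDatum.relIndex_unitLevel_eq (K := w.1.adicCompletion L) hτ hU1 (n := 4 * m) (by omega)
    (Un := U4) (fun u => by rw [hU4 u, h4, show (-((4 * m : ℕ) : ℤ)) = -(4 * (m : ℤ)) by push_cast; ring])
  rw [h, ← natCard_residueField_eq_of_compatible, natCard_residueField_eq_of_ramified (IsCMField.complexConj L) v hc1 w hw he]

end Literature.NumberTheory.Weil1982.UnitaryFinTopForm

end
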